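import Mathlib
import Literature.RingTheory.MvPolynomial.LinearFormsCoeff
import Summits.ValiantsHypothesis.ValiantsHypothesis.Theorems.RigidityForcesSymmetryRankRigidMinimalReprLaplaceFiveStarWedgePoly
import Summits.ValiantsHypothesis.ValiantsHypothesis.Theorems.RigidityForcesSymmetryRankRigidMinimalReprLaplaceFiveStarLemmaKDenominators

/-!
# ValiantsHypothesis / RigidityForcesSymmetry — crux `LaplaceOptimalFive` (stmt-ValiantsHypothesis-24813), crux idea
`young-shadow` (K1) on the star: **LEMMA K, EXIT (III) — A LINEAR FORM DIVIDING EVERY MINOR: SQUARE MEMBER OR COMMON FACTOR**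
(memo `NOTE-p4g15-24813-K1-star.md` §14 (c2) «`deg B = 1`», referee note `NOTE-crit3g5-24813-Lemma2prime-elementary.md` §B)

Exit (III) of the denominator trichotomy (✓ `LaplaceFiveStar.denominator_trichotomy`): a non-zero linear form `L = Σ l_z X_z` divides every
Jacobian minor `M_{ac} = ∂_aQ₁∂_cQ₂ − ∂_cQ₁∂_aQ₂` of two independent symmetric quadrics `Q_i = Σ C(U_i a b) X_a X_b`.  Then
(`square_or_commonFactor_of_linear_divisor`): EITHER the pencil contains a SQUARE (`s U₁ + t U₂ = λλᵀ`, `(s,t) ≠ 0`), OR `L` is a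
COMMON FACTOR: `U_i = l m_iᵀ + m_i lᵀ` (`Q_i = 2 L · M_i`).  Route (all finite algebra over `Fin 5`, no dimension theory):

* `parallel_on_hyperplane` — `U₁y ∥ U₂y` for every `y` on the hyperplane `H = {l·y = 0}` (evaluate `M_{ac} = L·S_{ac}`);
* `exists_member_vanishing_on_hyperplane` — with the test vectors `h_a = l_{z₀} e_a − l_a e_{z₀}` spanning `H`, the Gram-type matrices
  `B_i(a,b) = U_i(h_a, h_b)` are symmetric and pointwise parallel on ALL of `ℂ⁵`, so ✓ `proportional_of_parallel` makes them proportional: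
  some member `s U₁ + t U₂ ≠ 0` VANISHES ON `H × H`;
* `eq_symm_rankTwo_of_vanishing` — a symmetric matrix vanishing on `H × H` is `l mᵀ + m lᵀ` (explicit `m`); if `m ∥ l` this member is the
  SQUARE `c·l lᵀ`;
* `commonFactor_of_second_generator` — otherwise `L ∤ M = Σ m_z X_z`, and `L ∣ minors(L·M, Q'')` forces (primality of `L`,
  ✓ `prime_of_totalDegree_eq_one`) `l ∧ U''h = 0` on `H`, hence `U''` vanishes on `H × H` too: `L` divides BOTH generators.

No star hypotheses, no definitions, no `sorry`.  Honest framing: helper toward the Lean price (L2) of the K1-on-the-star theorem (PAPER,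
referee PASS; not kernel); `LaplaceOptimalFive` OPEN · CONTESTED 72/120; `VP ≠ VNP` NOT proved.
-/

set_option linter.dupNamespace false

namespace Summit.ValiantsHypothesis.ValiantsHypothesis.Theorems.RigidityForcesSymmetryRankRigidMinimalRepr

namespace LaplaceFiveStar

open Finset MvPolynomial

/-- Evaluation of a linear form: `(Σ_z l_z • X_z)(y) = Σ_z l_z y_z`. [folklore] -/
theorem eval_sum_smul_X (l y : Fin 5 → ℂ) :
    MvPolynomial.eval y (∑ z : Fin 5, l z • (X z : MvPolynomial (Fin 5) ℂ)) = ∑ z : Fin 5, l z * y z := by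
  rw [map_sum]
  exact Finset.sum_congr rfl fun z _ => by rw [smul_eval, eval_X]

/-- A linear form divisible by a non-zero linear form is a CONSTANT multiple of it (degrees add in a domain). [folklore] -/
theorem eq_C_mul_of_dvd_linear {K : Type*} [Field K] {σ : Type*} {L F : MvPolynomial σ K}
    (hL1 : L.IsHomogeneous 1) (hL0 : L ≠ 0) (hF1 : F.IsHomogeneous 1) (h : L ∣ F) : ∃ κ : K, F = C κ * L := by
  obtain ⟨S, hS⟩ := h
  by_cases hF0 : F = 0
  · exact ⟨0, by rw [hF0, C_0, zero_mul]⟩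
  have hS0 : S ≠ 0 := by
    rintro rfl
    exact hF0 (by rw [hS, mul_zero])
  have hdeg : F.totalDegree = L.totalDegree + S.totalDegree := by
    rw [hS, totalDegree_mul_of_isDomain hL0 hS0]
  rw [hF1.totalDegree hF0, hL1.totalDegree hL0] at hdeg
  have hS' : S.totalDegree = 0 := by omega
  rw [totalDegree_eq_zero_iff_eq_C] at hS'
  obtain ⟨κ, hκ⟩ : ∃ κ : K, S = C κ := ⟨coeff 0 S, hS'⟩
  exact ⟨κ, by rw [hS, hκ]; ring⟩

/-- **Parallel on the hyperplane.**  If the linear form `L = Σ l_z X_z` divides every Jacobian minor of the symmetric quadrics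
`Q₁, Q₂`, then `U₁y ∥ U₂y` (all `2 × 2` minors of `[U₁y | U₂y]` vanish) for every `y` with `l·y = 0`. [folklore] -/
theorem parallel_on_hyperplane (U₁ U₂ : Fin 5 → Fin 5 → ℂ)
    (hU1 : ∀ a b : Fin 5, U₁ a b = U₁ b a) (hU2 : ∀ a b : Fin 5, U₂ a b = U₂ b a)
    (Q₁ Q₂ : MvPolynomial (Fin 5) ℂ)
    (hQ₁ : Q₁ = ∑ a : Fin 5, ∑ b : Fin 5, C (U₁ a b) * X a * X b)
    (hQ₂ : Q₂ = ∑ a : Fin 5, ∑ b : Fin 5, C (U₂ a b) * X a * X b)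
    (l : Fin 5 → ℂ) (L : MvPolynomial (Fin 5) ℂ) (hL : L = ∑ z : Fin 5, l z • (X z : MvPolynomial (Fin 5) ℂ))
    (hdiv : ∀ a c : Fin 5, L ∣ pderiv a Q₁ * pderiv c Q₂ - pderiv c Q₁ * pderiv a Q₂)
    (y : Fin 5 → ℂ) (hy : ∑ z : Fin 5, l z * y z = 0) (a c : Fin 5) :
    (∑ d : Fin 5, U₁ a d * y d) * (∑ d : Fin 5, U₂ c d * y d)
      = (∑ d : Fin 5, U₁ c d * y d) * (∑ d : Fin 5, U₂ a d * y d) := by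
  obtain ⟨S, hS⟩ := hdiv a c
  have h := congr_arg (MvPolynomial.eval y) hS
  rw [map_mul, hL, eval_sum_smul_X, hy, zero_mul, map_sub, map_mul, map_mul, hQ₁, hQ₂,
    eval_pderiv_quadric U₁ hU1, eval_pderiv_quadric U₁ hU1, eval_pderiv_quadric U₂ hU2,
    eval_pderiv_quadric U₂ hU2] at h
  linear_combination h / 4

/-- **A symmetric matrix vanishing on `H × H` has the shape `l mᵀ + m lᵀ`.**  Here `H = {l·y = 0}` with `l_{z₀} ≠ 0`, and «vanishing
on `H × H`» is tested on the spanning vectors `h_a = l_{z₀} e_a − l_a e_{z₀}`: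
`M(h_a, h_b) = l_{z₀}(l_{z₀} M_{ab} − l_b M_{a z₀}) − l_a (l_{z₀} M_{z₀ b} − l_b M_{z₀ z₀}) = 0`. [folklore] -/
theorem eq_symm_rankTwo_of_vanishing (M : Fin 5 → Fin 5 → ℂ) (hM : ∀ a b : Fin 5, M a b = M b a)
    (l : Fin 5 → ℂ) (z₀ : Fin 5) (hl : l z₀ ≠ 0)
    (h : ∀ a b : Fin 5, l z₀ * (l z₀ * M a b - l b * M a z₀) - l a * (l z₀ * M z₀ b - l b * M z₀ z₀) = 0) :
    ∃ m : Fin 5 → ℂ, ∀ a b : Fin 5, M a b = l a * m b + m a * l b := by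
  refine ⟨fun b => M z₀ b / l z₀ - M z₀ z₀ * l b / (2 * l z₀ * l z₀), fun a b => ?_⟩
  have hab := h a b
  rw [hM a z₀] at hab
  field_simp [hl]
  linear_combination 2 * hab

/-- **Some non-trivial member of the pencil vanishes on `H × H`.**  If `U₁y ∥ U₂y` for all `y ∈ H = {l·y = 0}`, then
for some `(s,t) ≠ (0,0)` the member `s U₁ + t U₂` vanishes on `H × H` (tested on the vectors `h_a`).  Proof: the matrices
`B_i(a,b) := U_i(h_a, h_b)` are symmetric and `B₁Y ∥ B₂Y` for EVERY `Y ∈ ℂ⁵`, so ✓ `proportional_of_parallel` applies. [folklore] -/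
theorem exists_member_vanishing_on_hyperplane (U₁ U₂ : Fin 5 → Fin 5 → ℂ)
    (hU1 : ∀ a b : Fin 5, U₁ a b = U₁ b a) (hU2 : ∀ a b : Fin 5, U₂ a b = U₂ b a)
    (l : Fin 5 → ℂ) (z₀ : Fin 5)
    (hpar : ∀ y : Fin 5 → ℂ, ∑ z : Fin 5, l z * y z = 0 → ∀ a c : Fin 5,
      (∑ d : Fin 5, U₁ a d * y d) * (∑ d : Fin 5, U₂ c d * y d)
        = (∑ d : Fin 5, U₁ c d * y d) * (∑ d : Fin 5, U₂ a d * y d)) :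
    ∃ s t : ℂ, (s ≠ 0 ∨ t ≠ 0) ∧ ∀ a b : Fin 5,
      l z₀ * (l z₀ * (s * U₁ a b + t * U₂ a b) - l b * (s * U₁ a z₀ + t * U₂ a z₀))
        - l a * (l z₀ * (s * U₁ z₀ b + t * U₂ z₀ b) - l b * (s * U₁ z₀ z₀ + t * U₂ z₀ z₀)) = 0 := by
  classical
  -- the Gram-type matrices on the test vectors `h_a = l_{z₀} e_a − l_a e_{z₀}`
  set B₁ : Fin 5 → Fin 5 → ℂ := fun a b =>
    l z₀ * (l z₀ * U₁ a b - l b * U₁ a z₀) - l a * (l z₀ * U₁ z₀ b - l b * U₁ z₀ z₀) with hB₁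
  set B₂ : Fin 5 → Fin 5 → ℂ := fun a b =>
    l z₀ * (l z₀ * U₂ a b - l b * U₂ a z₀) - l a * (l z₀ * U₂ z₀ b - l b * U₂ z₀ z₀) with hB₂
  have hB1s : ∀ a b : Fin 5, B₁ a b = B₁ b a := fun a b => by
    simp only [hB₁]; rw [hU1 a b, hU1 a z₀, hU1 b z₀]; ring
  have hB2s : ∀ a b : Fin 5, B₂ a b = B₂ b a := fun a b => by
    simp only [hB₂]; rw [hU2 a b, hU2 a z₀, hU2 b z₀]; ring
  -- `(B_i Y)_a = l_{z₀} v_a − l_a v_{z₀}` with `v = U_i h`, `h = l_{z₀} Y − (l·Y) e_{z₀} ∈ H`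
  have hBY : ∀ (U : Fin 5 → Fin 5 → ℂ) (Y : Fin 5 → ℂ) (a : Fin 5),
      ∑ b : Fin 5, (l z₀ * (l z₀ * U a b - l b * U a z₀) - l a * (l z₀ * U z₀ b - l b * U z₀ z₀)) * Y b
        = l z₀ * (l z₀ * (∑ b : Fin 5, U a b * Y b) - (∑ b : Fin 5, l b * Y b) * U a z₀)
          - l a * (l z₀ * (∑ b : Fin 5, U z₀ b * Y b) - (∑ b : Fin 5, l b * Y b) * U z₀ z₀) := by
    intro U Y a
    have e : ∀ b : Fin 5, (l z₀ * (l z₀ * U a b - l b * U a z₀) - l a * (l z₀ * U z₀ b - l b * U z₀ z₀)) * Y b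
        = l z₀ * l z₀ * (U a b * Y b) - l z₀ * U a z₀ * (l b * Y b) - l a * l z₀ * (U z₀ b * Y b)
          + l a * U z₀ z₀ * (l b * Y b) := fun b => by ring
    rw [Finset.sum_congr rfl fun b _ => e b, Finset.sum_add_distrib, Finset.sum_sub_distrib, Finset.sum_sub_distrib,
      ← Finset.mul_sum, ← Finset.mul_sum, ← Finset.mul_sum, ← Finset.mul_sum]
    ring
  -- the shifted vector `h` lies on `H`, and `U h = l_{z₀} U Y − (l·Y) U e_{z₀}`
  have hUh : ∀ (U : Fin 5 → Fin 5 → ℂ) (Y : Fin 5 → ℂ) (x : Fin 5),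
      ∑ d : Fin 5, U x d * (l z₀ * Y d - (∑ b : Fin 5, l b * Y b) * (if d = z₀ then 1 else 0))
        = l z₀ * (∑ b : Fin 5, U x b * Y b) - (∑ b : Fin 5, l b * Y b) * U x z₀ := by
    intro U Y x
    set c : ℂ := ∑ b : Fin 5, l b * Y b with hc
    have e : ∀ d : Fin 5, U x d * (l z₀ * Y d - c * (if d = z₀ then 1 else 0))
        = l z₀ * (U x d * Y d) - (if d = z₀ then c * U x d else 0) := by
      intro d
      split_ifs <;> ring
    rw [Finset.sum_congr rfl fun d _ => e d, Finset.sum_sub_distrib, ← Finset.mul_sum, Finset.sum_ite_eq',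
      if_pos (Finset.mem_univ _)]
  have hlh : ∀ Y : Fin 5 → ℂ,
      ∑ z : Fin 5, l z * (l z₀ * Y z - (∑ b : Fin 5, l b * Y b) * (if z = z₀ then 1 else 0)) = 0 := by
    intro Y
    set c : ℂ := ∑ b : Fin 5, l b * Y b with hc
    have e : ∀ z : Fin 5, l z * (l z₀ * Y z - c * (if z = z₀ then 1 else 0))
        = l z₀ * (l z * Y z) - (if z = z₀ then c * l z else 0) := by
      intro z
      split_ifs <;> ring
    rw [Finset.sum_congr rfl fun z _ => e z, Finset.sum_sub_distrib, ← Finset.mul_sum, Finset.sum_ite_eq',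
      if_pos (Finset.mem_univ _), ← hc]
    ring
  -- `B₁ Y ∥ B₂ Y` for every `Y`
  have hparB : ∀ (Y : Fin 5 → ℂ) (a c : Fin 5),
      (∑ d : Fin 5, B₁ a d * Y d) * (∑ d : Fin 5, B₂ c d * Y d)
        = (∑ d : Fin 5, B₁ c d * Y d) * (∑ d : Fin 5, B₂ a d * Y d) := by
    intro Y a c
    simp only [hB₁, hB₂]
    rw [hBY U₁ Y a, hBY U₂ Y c, hBY U₁ Y c, hBY U₂ Y a]
    set h : Fin 5 → ℂ := fun d => l z₀ * Y d - (∑ b : Fin 5, l b * Y b) * (if d = z₀ then 1 else 0) with hh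
    have m1 := hpar h (hlh Y) a c
    have m2 := hpar h (hlh Y) a z₀
    have m3 := hpar h (hlh Y) z₀ c
    simp only [hh, hUh] at m1 m2 m3
    linear_combination (l z₀ * l z₀) * m1 - (l z₀ * l c) * m2 - (l z₀ * l a) * m3
  -- hence `B₁, B₂` are proportional
  have hprop := proportional_of_parallel B₁ B₂ hB1s hB2s hparB
  by_cases hB10 : ∀ a b : Fin 5, B₁ a b = 0
  · refine ⟨1, 0, Or.inl one_ne_zero, fun a b => ?_⟩
    have h := hB10 a b
    simp only [hB₁] at h
    linear_combination h
  · simp only [not_forall] at hB10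
    obtain ⟨c, d, hcd⟩ := hB10
    refine ⟨B₂ c d, -B₁ c d, Or.inr (neg_ne_zero.mpr hcd), fun a b => ?_⟩
    have h := hprop a b c d
    simp only [hB₁, hB₂] at h ⊢
    linear_combination h

/-- **The second generator.**  `l` with `l_{z₀} ≠ 0`, `m ∦ l`, `L = Σ l_z X_z`, `M = Σ m_z X_z`; a symmetric quadric `Q''` with matrix
`U''` such that `L` divides `(l_a M + m_a L) ∂_cQ'' − (l_c M + m_c L) ∂_aQ''` for all `a, c` (these are, up to the factor `2`, the
Jacobian minors of the pair `(L·M, Q'')`).  Then `U'' = l m''ᵀ + m'' lᵀ`: `L` divides `Q''` as well.  Proof: `L` is prime and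
`L ∤ M`, so `L ∣ l_a ∂_cQ'' − l_c ∂_aQ''`, i.e. `U''h ∥ l` on `H`, whence `U''` vanishes on `H × H`. [folklore] -/
theorem commonFactor_of_second_generator (l m : Fin 5 → ℂ) (z₀ : Fin 5) (hl : l z₀ ≠ 0)
    (i j : Fin 5) (hij : l i * m j - l j * m i ≠ 0)
    (U'' : Fin 5 → Fin 5 → ℂ) (hU : ∀ a b : Fin 5, U'' a b = U'' b a)
    (Q'' : MvPolynomial (Fin 5) ℂ) (hQ : Q'' = ∑ a : Fin 5, ∑ b : Fin 5, C (U'' a b) * X a * X b)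
    (hdiv : ∀ a c : Fin 5,
      (∑ z : Fin 5, l z • (X z : MvPolynomial (Fin 5) ℂ)) ∣
        (C (l a) * (∑ z : Fin 5, m z • (X z : MvPolynomial (Fin 5) ℂ)) + C (m a) * (∑ z : Fin 5, l z • (X z : MvPolynomial (Fin 5) ℂ)))
            * pderiv c Q''
          - (C (l c) * (∑ z : Fin 5, m z • (X z : MvPolynomial (Fin 5) ℂ)) + C (m c) * (∑ z : Fin 5, l z • (X z : MvPolynomial (Fin 5) ℂ)))
            * pderiv a Q'') :
    ∃ m'' : Fin 5 → ℂ, ∀ a b : Fin 5, U'' a b = l a * m'' b + m'' a * l b := by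
  classical
  set L : MvPolynomial (Fin 5) ℂ := ∑ z : Fin 5, l z • (X z : MvPolynomial (Fin 5) ℂ) with hL
  set Mf : MvPolynomial (Fin 5) ℂ := ∑ z : Fin 5, m z • (X z : MvPolynomial (Fin 5) ℂ) with hMf
  have hL1 : L.IsHomogeneous 1 := Literature.RingTheory.MvPolynomial.isHomogeneous_one_sum_smul_X l
  have hMf1 : Mf.IsHomogeneous 1 := Literature.RingTheory.MvPolynomial.isHomogeneous_one_sum_smul_X m
  have hL0 : L ≠ 0 := by
    intro h
    have := (Literature.RingTheory.MvPolynomial.sum_smul_X_eq_zero_iff l).mp h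
    exact hl (by rw [this]; rfl)
  have hLprime : Prime L := prime_of_totalDegree_eq_one (hL1.totalDegree hL0)
  -- `L ∤ Mf` since `m ∦ l`
  have hLM : ¬ L ∣ Mf := by
    intro h
    obtain ⟨κ, hκ⟩ := eq_C_mul_of_dvd_linear hL1 hL0 hMf1 h
    have hm : ∀ z : Fin 5, m z = κ * l z := by
      intro z
      have h1 := congr_arg (coeff (Finsupp.single z 1)) hκ
      rw [hMf, Literature.RingTheory.MvPolynomial.coeff_single_one_sum_smul_X, coeff_C_mul, hL,
        Literature.RingTheory.MvPolynomial.coeff_single_one_sum_smul_X] at h1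
      exact h1
    apply hij
    rw [hm i, hm j]
    ring
  -- `L ∣ l_a ∂_c Q'' − l_c ∂_a Q''`, a linear form, hence a constant multiple of `L`
  have hP1 : ∀ c : Fin 5, (pderiv c Q'').IsHomogeneous 1 := fun c => by
    rw [hQ]; exact (quadric_isHomogeneous U'').pderiv
  have hG : ∀ a c : Fin 5, ∃ κ : ℂ, C (l a) * pderiv c Q'' - C (l c) * pderiv a Q'' = C κ * L := by
    intro a c
    have h1 : L ∣ Mf * (C (l a) * pderiv c Q'' - C (l c) * pderiv a Q'') := by
      have h := hdiv a c
      have e : (C (l a) * Mf + C (m a) * L) * pderiv c Q'' - (C (l c) * Mf + C (m c) * L) * pderiv a Q''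
          = Mf * (C (l a) * pderiv c Q'' - C (l c) * pderiv a Q'') + L * (C (m a) * pderiv c Q'' - C (m c) * pderiv a Q'') := by
        ring
      rw [e] at h
      exact (dvd_add_left (dvd_mul_right L _)).mp h
    have h2 : L ∣ C (l a) * pderiv c Q'' - C (l c) * pderiv a Q'' := (hLprime.dvd_or_dvd h1).resolve_left hLM
    exact eq_C_mul_of_dvd_linear hL1 hL0 (((isHomogeneous_C _ _).mul (hP1 c)).sub ((isHomogeneous_C _ _).mul (hP1 a))) h2
  -- test vectors `h_b = l_{z₀} e_b − l_b e_{z₀}`: `ν = U'' h_b` is parallel to `l`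
  have hν : ∀ b a c : Fin 5,
      l a * (l z₀ * U'' c b - l b * U'' c z₀) = l c * (l z₀ * U'' a b - l b * U'' a z₀) := by
    intro b a c
    obtain ⟨κ, hκ⟩ := hG a c
    have e := congr_arg (MvPolynomial.eval
      (fun d => l z₀ * (if d = b then 1 else 0) - l b * (if d = z₀ then 1 else 0))) hκ
    rw [map_sub, map_mul, map_mul, eval_C, eval_C, hQ, eval_pderiv_quadric U'' hU, eval_pderiv_quadric U'' hU,
      map_mul, eval_C, hL, eval_sum_smul_X] at e
    simp only [mul_sub, mul_ite, mul_one, mul_zero, Finset.sum_sub_distrib, Finset.sum_ite_eq', Finset.mem_univ,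
      if_true] at e
    linear_combination e / 2
  -- hence `U''` vanishes on `H × H` (test-vector form) and has the shape `l m''ᵀ + m'' lᵀ`
  exact eq_symm_rankTwo_of_vanishing U'' hU l z₀ hl fun a b => by linear_combination -(hν b a z₀)

/-- **LEMMA K, exit (III).**  Two independent symmetric quadrics `Q₁, Q₂` and a non-zero linear form `L` dividing every Jacobian minor
`∂_aQ₁∂_cQ₂ − ∂_cQ₁∂_aQ₂`.  Then EITHER the pencil contains a SQUARE (`s U₁ + t U₂ = λλᵀ`, `(s,t) ≠ 0`), OR `L = Σ l_z X_z` is a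
COMMON FACTOR of the pencil: `U_i = l m_iᵀ + m_i lᵀ` for `i = 1, 2`. [folklore] -/
theorem square_or_commonFactor_of_linear_divisor (U₁ U₂ : Fin 5 → Fin 5 → ℂ)
    (hU1 : ∀ a b : Fin 5, U₁ a b = U₁ b a) (hU2 : ∀ a b : Fin 5, U₂ a b = U₂ b a)
    (hind : ∀ s t : ℂ, (∀ x w : Fin 5, s * U₁ x w + t * U₂ x w = 0) → s = 0 ∧ t = 0)
    (Q₁ Q₂ : MvPolynomial (Fin 5) ℂ)
    (hQ₁ : Q₁ = ∑ a : Fin 5, ∑ b : Fin 5, C (U₁ a b) * X a * X b)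
    (hQ₂ : Q₂ = ∑ a : Fin 5, ∑ b : Fin 5, C (U₂ a b) * X a * X b)
    (L : MvPolynomial (Fin 5) ℂ) (hL1 : L.IsHomogeneous 1) (hL0 : L ≠ 0)
    (hdiv : ∀ a c : Fin 5, L ∣ pderiv a Q₁ * pderiv c Q₂ - pderiv c Q₁ * pderiv a Q₂) :
    (∃ lam : Fin 5 → ℂ, ∃ s t : ℂ, (s ≠ 0 ∨ t ≠ 0) ∧ ∀ x w : Fin 5, s * U₁ x w + t * U₂ x w = lam x * lam w) ∨
    (∃ l m₁ m₂ : Fin 5 → ℂ, (∃ z₀, l z₀ ≠ 0) ∧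
      ∀ x w : Fin 5, U₁ x w = l x * m₁ w + m₁ x * l w ∧ U₂ x w = l x * m₂ w + m₂ x * l w) := by
  classical
  -- the coefficient vector of `L`
  set l : Fin 5 → ℂ := fun z => coeff (Finsupp.single z 1) L with hl_def
  have hL : L = ∑ z : Fin 5, l z • (X z : MvPolynomial (Fin 5) ℂ) :=
    Literature.RingTheory.MvPolynomial.eq_sum_coeff_single_one_smul_X hL1
  obtain ⟨z₀, hz₀⟩ : ∃ z₀, l z₀ ≠ 0 := by
    by_contra h
    simp only [not_exists, not_not] at h
    apply hL0
    rw [hL]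
    exact Finset.sum_eq_zero fun z _ => by rw [h z, zero_smul]
  -- (a) parallel on the hyperplane; (b,c) a member vanishing on `H × H`; (d) its shape `l mᵀ + m lᵀ`
  have hpar := parallel_on_hyperplane U₁ U₂ hU1 hU2 Q₁ Q₂ hQ₁ hQ₂ l L hL hdiv
  obtain ⟨s, t, hst, hvan⟩ := exists_member_vanishing_on_hyperplane U₁ U₂ hU1 hU2 l z₀ hpar
  have hMs : ∀ a b : Fin 5, s * U₁ a b + t * U₂ a b = s * U₁ b a + t * U₂ b a := fun a b => by
    rw [hU1 a b, hU2 a b]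
  obtain ⟨m, hm⟩ := eq_symm_rankTwo_of_vanishing (fun a b => s * U₁ a b + t * U₂ a b) hMs l z₀ hz₀ hvan
  by_cases hpl : ∀ i j : Fin 5, l i * m j - l j * m i = 0
  · -- `m ∥ l`: the member is a square
    left
    have hmz : ∀ z : Fin 5, m z = m z₀ / l z₀ * l z := fun z => by
      rw [div_mul_eq_mul_div, eq_div_iff hz₀]
      linear_combination hpl z₀ z
    by_cases hm0 : m z₀ = 0
    · exfalso
      have hzero : ∀ x w : Fin 5, s * U₁ x w + t * U₂ x w = 0 := fun x w => by
        rw [hm x w, hmz x, hmz w, hm0]; ring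
      obtain ⟨hs, ht⟩ := hind s t hzero
      rcases hst with h | h
      · exact h hs
      · exact h ht
    · have hcne : 2 * m z₀ / l z₀ ≠ 0 := div_ne_zero (mul_ne_zero two_ne_zero hm0) hz₀
      refine ⟨l, s / (2 * m z₀ / l z₀), t / (2 * m z₀ / l z₀), ?_, fun x w => ?_⟩
      · rcases hst with h | h
        · exact Or.inl (div_ne_zero h hcne)
        · exact Or.inr (div_ne_zero h hcne)
      · have h := hm x w
        rw [hmz x, hmz w] at h
        rw [div_mul_eq_mul_div, div_mul_eq_mul_div, ← add_div, div_eq_iff hcne]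
        linear_combination h
  · -- `m ∦ l`: `L` divides the second generator too
    right
    simp only [not_forall] at hpl
    obtain ⟨i, j, hij⟩ := hpl
    set Mf : MvPolynomial (Fin 5) ℂ := ∑ z : Fin 5, m z • (X z : MvPolynomial (Fin 5) ℂ) with hMf
    -- gradient of the member `s Q₁ + t Q₂ = 2 L·M`
    have hP' : ∀ a : Fin 5, C s * pderiv a Q₁ + C t * pderiv a Q₂ = 2 * (C (l a) * Mf + C (m a) * L) := by
      intro a
      rw [hQ₁, hQ₂, pderiv_quadric, pderiv_quadric, hMf, hL, Finset.mul_sum, Finset.mul_sum,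
        ← Finset.sum_add_distrib, Finset.mul_sum, Finset.mul_sum, ← Finset.sum_add_distrib, Finset.mul_sum]
      refine Finset.sum_congr rfl fun b _ => ?_
      have hC := congr_arg (C : ℂ → MvPolynomial (Fin 5) ℂ) (hm a b)
      rw [hU1 b a, hU2 b a, smul_eq_C_mul, smul_eq_C_mul]
      simp only [map_add, map_mul] at hC ⊢
      linear_combination 2 * X b * hC
    have two0 : (2 : MvPolynomial (Fin 5) ℂ) ≠ 0 := by exact_mod_cast (by norm_num : (2 : ℕ) ≠ 0)
    by_cases hs : s ≠ 0
    · -- second generator `Q₂`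
      have hdiv' : ∀ a c : Fin 5, L ∣ (C (l a) * Mf + C (m a) * L) * pderiv c Q₂ - (C (l c) * Mf + C (m c) * L) * pderiv a Q₂ := by
        intro a c
        obtain ⟨S, hS⟩ := hdiv a c
        have key : (2 : MvPolynomial (Fin 5) ℂ) *
            ((C (l a) * Mf + C (m a) * L) * pderiv c Q₂ - (C (l c) * Mf + C (m c) * L) * pderiv a Q₂)
            = C s * (L * S) := by
          rw [← hS]
          linear_combination (-(pderiv c Q₂)) * hP' a + (pderiv a Q₂) * hP' c
        have h2 : (2 : MvPolynomial (Fin 5) ℂ) * C (2⁻¹ : ℂ) = 1 := by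
          rw [show (2 : MvPolynomial (Fin 5) ℂ) = C (2 : ℂ) from (map_ofNat C 2).symm, ← C_mul,
            mul_inv_cancel₀ two_ne_zero, C_1]
        refine ⟨C (2⁻¹ : ℂ) * C s * S, mul_left_cancel₀ two0 ?_⟩
        rw [key]
        linear_combination (-(C s * L * S)) * h2
      rw [hL] at hdiv'
      obtain ⟨m₂, hm₂⟩ := commonFactor_of_second_generator l m z₀ hz₀ i j hij U₂ hU2 Q₂ hQ₂ hdiv'
      refine ⟨l, fun w => (m w - t * m₂ w) / s, m₂, ⟨z₀, hz₀⟩, fun x w => ⟨?_, hm₂ x w⟩⟩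
      rw [mul_div_assoc', div_mul_eq_mul_div, ← add_div, eq_div_iff hs]
      linear_combination hm x w - t * hm₂ x w
    · -- `s = 0`, `t ≠ 0`: second generator `Q₁`
      have hs0 : s = 0 := by
        by_contra h
        exact hs h
      have ht : t ≠ 0 := hst.resolve_left (fun h => h hs0)
      have hdiv' : ∀ a c : Fin 5, L ∣ (C (l a) * Mf + C (m a) * L) * pderiv c Q₁ - (C (l c) * Mf + C (m c) * L) * pderiv a Q₁ := by
        intro a c
        obtain ⟨S, hS⟩ := hdiv a c
        have key : (2 : MvPolynomial (Fin 5) ℂ) *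
            ((C (l a) * Mf + C (m a) * L) * pderiv c Q₁ - (C (l c) * Mf + C (m c) * L) * pderiv a Q₁)
            = - C t * (L * S) := by
          rw [← hS]
          have e1 := hP' a
          have e2 := hP' c
          rw [hs0, C_0, zero_mul, zero_add] at e1 e2
          linear_combination (-(pderiv c Q₁)) * e1 + (pderiv a Q₁) * e2
        have h2 : (2 : MvPolynomial (Fin 5) ℂ) * C (2⁻¹ : ℂ) = 1 := by
          rw [show (2 : MvPolynomial (Fin 5) ℂ) = C (2 : ℂ) from (map_ofNat C 2).symm, ← C_mul,
            mul_inv_cancel₀ two_ne_zero, C_1]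
        refine ⟨- (C (2⁻¹ : ℂ) * C t * S), mul_left_cancel₀ two0 ?_⟩
        rw [key]
        linear_combination (C t * L * S) * h2
      rw [hL] at hdiv'
      obtain ⟨m₁, hm₁⟩ := commonFactor_of_second_generator l m z₀ hz₀ i j hij U₁ hU1 Q₁ hQ₁ hdiv'
      refine ⟨l, m₁, fun w => m w / t, ⟨z₀, hz₀⟩, fun x w => ⟨hm₁ x w, ?_⟩⟩
      rw [mul_div_assoc', div_mul_eq_mul_div, ← add_div, eq_div_iff ht]
      have h := hm x w
      rw [hs0, zero_mul, zero_add] at h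
      linear_combination h

end LaplaceFiveStar

end Summit.ValiantsHypothesis.ValiantsHypothesis.Theorems.RigidityForcesSymmetryRankRigidMinimalRepr
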